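import Literature.Geometry.Lorentzian.KerrSeparatedTrapping
import HarnessLib

/-!
# The frequency ranges of DRSR §8.1 and the near-superradiant strip: the printed strip
# `mω ∈ (0, am²/(2Mr₊) + αΛ]` is too wide (Lemmas 6.4.2 and 8.1.1 fail as printed), and the
# repaired strip `mω ∈ (0, am²/(2Mr₊) + α|m|√Λ]`, for which §6.4 and §8.1 are proved

(family `gr`, infrastructure for statement **gr.S24**; namespace `Literature.Geometry.Lorentzian.Kerr`)

Source: Dafermos–Rodnianski–Shlapentokh-Rothman, *Decay for solutions of the wave equation on
Kerr exterior spacetimes III: the full subextremal case `|a| < M`*, arXiv:1402.7034 = Ann. of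
Math. 183 (2016) (the held text is the arXiv TeX source; the journal version could not be
compared). This file continues `KerrSeparatedPotential.lean` / `KerrSeparatedTrapping.lean`
(DRSR §6, proved) into §8.1 ("The frequency ranges"), the bookkeeping on which the proof of the
frequency-localised estimate Theorem 8.1 rests (§8.8: "Since these ranges cover all admissible
frequencies, the proof is complete"). Everything below is **proved**; no named facts.

## What is printed

With `ω₊ = a/(2Mr₊)` (`Kerr.horizonAngularVelocity`) and a parameter `α > 0` fixed from
Lemma 6.4.1, §8.1 defines, for parameters `ω_high, ε_width > 0`, five ranges of admissible
triples (Def. 6.1.1, `Kerr.IsAdmissibleTriple`):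
`𝓖^♯ = {Λ ≥ (ω₊ + α)⁻² ω_high², mω ∈ (0, ω₊m² + αΛ]}`,
`𝓖_♯ = {|ω| ≥ ω_high, Λ < ε_width ω², mω ∉ (0, ω₊m² + αΛ]}`,
`𝓖_𝄬 = {Λ ≥ ε_width⁻¹ ω_high², ε_width Λ > ω², mω ∉ (0, ω₊m² + αΛ]}`,
`𝓖_♮ = {|ω| ≥ ω_high, ε_width Λ ≤ ω² ≤ ε_width⁻¹ Λ, mω ∉ (0, ω₊m² + αΛ]}`,
`𝓖_♭ = {|ω| < ω_high, Λ < ε_width⁻¹ ω_high²}`,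
and Lemma 8.1.1 asserts that every admissible triple lies in exactly one of them, the proof
being the displayed implication `|ω| ≥ ω_high ∧ mω ∈ (0, ω₊m² + αΛ] ⇒ Λ ≥ (ω₊ + α)⁻² ω_high²`.
The strip `mω ∈ (0, ω₊m² + αΛ]` ("a range of frequency parameters including the superradiant
regime", §6.4) is also the hypothesis of the `α`-clauses of Lemma 6.4.1 (`dV₀/dr(r₊) ≥ bΛ`) and of
Lemma 6.4.2 (`bΛ ≤ V₀(r⁰_max) − ω²`, "superradiant frequencies are not trapped"; proof: "it suffices
to prove the lemma with `α = 0`"), and Prop. 8.3.1 (the range `𝓖^♯`) invokes both clauses.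

## What this file shows

* `Kerr.IsNearSuperradiant M a α ω m Λ` — the printed strip; `Kerr.IsFreqSharpSup/SharpSub/
  Lessflat/Natural/Flat` — the five ranges, written for an arbitrary strip predicate `S` so that
  the printed ranges (`S =` printed strip) and the repaired ones (`S =` repaired strip) are the
  same definitions (`𝓖^♯`'s threshold is written multiplied out, `ω_high² ≤ (ω₊ + α)²Λ`,
  `isFreqSharpSup_threshold_iff`).
* **The printed Lemma 8.1.1 is false** (`exists_admissible_not_mem_freqRanges_printed`): for
  `M > 0`, `a ≥ 0`, every `α > 0`, every `ε_width` and all sufficiently large `ω_high`, the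
  admissible triple `ω = ω_high`, `m = 1`, `Λ = max(2, ω_high/α, 2aω_high)` lies in the printed
  strip (so not in `𝓖_♯`, `𝓖_𝄬`, `𝓖_♮`), has `|ω| = ω_high` (not in `𝓖_♭`) and
  `Λ = O(ω_high) < (ω₊ + α)⁻² ω_high²` (not in `𝓖^♯`): the displayed implication fails, the term
  `αΛ` allowing `|ω| ≈ αΛ/|m| ≫ √Λ`.
* **The printed `α`-clause of Lemma 6.4.2 is false for every `α > 0`**
  (`exists_isNearSuperradiant_sepPotential₀_sub_sq_le`, `not_lemma_6_4_2_alpha_printed`): the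
  admissible strip triple `m = 1`, `ω = t`, `Λ = max(2, t/α, 2at)` with `t` large has
  `V₀(r) − ω² ≤ −Λ` for **all** `r ≥ r₊` (`V₀ ≤ 3Λ/M²` on `r ≥ r₊` while `ω² ≥ (3/M² + 1)Λ`), so no
  `b ≥ 0` works, wherever `r⁰_max` is; and for every `ω_high` such a triple lies in the printed range
  `𝓖^♯(ω_high)` (`exists_isFreqSharpSup_printed_sepPotential₀_sub_sq_le`), whose treatment
  (Prop. 8.3.1, proof, first paragraph) starts from "`V₀(r⁰_max) − ω² ≥ cΛ`". (The `α = 0`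
  statement, Lemma 6.4.2 proper, is proved in `KerrSeparatedTrapping.lean`; what fails is the
  reduction "it suffices to prove `α = 0`": moving `mω` by `αΛ` moves `ω²` by up to
  `2|ω|αΛ/|m| + α²Λ²/m²`, not `O(αΛ)`.)
* **The repair.** With the strip `Kerr.IsNearSuperradiant' M a α ω m Λ :
  0 < mω ≤ ω₊m² + α|m|√Λ` (for admissible triples a subset of the printed strip,
  `IsNearSuperradiant'.isNearSuperradiant`, since `|m|√Λ ≤ Λ`; it contains the superradiant
  frequencies `0 < mω ≤ ω₊m²`):
  - Lemma 8.1.1's displayed implication holds **with the printed constant**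
    (`sq_le_of_isNearSuperradiant'`: `|ω| ≤ ω₊|m| + α√Λ ≤ (ω₊ + α)√Λ`), and the five ranges cover
    all admissible triples as soon as `0 < ε_width ≤ (ω₊ + α)²` (`freqRanges'_cover`; the paper
    takes `ε_width` small). ("Exactly one" is not formalised: it is not used in §8.8, and as
    printed `𝓖^♯ ∩ 𝓖_♭` need not be empty.)
  - Lemma 6.4.1's `α`-clause holds with the same explicit constant as for the printed strip
    (`le_deriv_sepPotential₀_rPlus_alpha'`, from `le_deriv_sepPotential₀_rPlus_alpha`).
  - **Lemma 6.4.2's `α`-clause holds** (`exists_sepPotential₀_rmax_sub_sq_ge'`): for `0 < M`,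
    `0 ≤ a < M` there are explicit `α₀ > 0`, `b > 0` such that for `0 ≤ α ≤ α₀` and every admissible
    triple in the repaired strip, `V₀` has a unique critical point `r⁰_max ∈ (r₊, 7M)`, its global
    maximum on `(r₊, ∞)`, and `V₀(r⁰_max) − ω² ≥ bΛ`. Proof: `V₀` is nondecreasing in `mω`
    (`4Mra ≥ 0`), so compare with the threshold triple `(ω₊m, m, Λ)` (admissible, `α = 0` case)
    and use `ω² − ω₊²m² ≤ α√Λ(2ω₊|m| + α√Λ) ≤ (2ω₊α + α²)Λ`; for `a = 0` directly
    `V₀(4M) ≥ 8Λ/(289M²)` and `ω² ≤ α²Λ`.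
  - The two downstream uses of the strip's complement survive verbatim: in `𝓖_𝄬` with
    `ε_width ≤ α²` one has `mω ≤ 0` (proof of Prop. 8.5.1, (mBigOmega)–(omegaBigm);
    `mul_nonpos_of_isFreqLessflat'`, and for the printed strip `mul_nonpos_of_isFreqLessflat`),
    and off the strip with `ε_width Λ ≤ ω²` one has `ω² − V₀(r₊) = (ω − ω₊m)² ≥ min(ε_width, α²)Λ`
    (proof of Lemma 8.6.1, first display; `min_mul_le_sq_sub_of_not_isNearSuperradiant'`,
    `min_mul_le_sq_sub_sepPotential₀_rPlus`).

Scope. Nothing here bears on the truth of Theorem 8.1 or Theorem 3.1 of the source; it records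
that, as printed in the arXiv text, the partition of §8.1 and the `α`-clause of Lemma 6.4.2 do not
hold, and that the one-symbol change `αΛ ↦ α|m|√Λ` in the strip restores Lemmas 6.4.1, 6.4.2,
8.1.1 and the uses of the strip in §§8.5–8.6 with the printed constants. The same strip
hypothesis `0 < mω ≤ m²ω₊ + β₁Λ` reappears in Shlapentokh-Rothman–Teixeira da Costa,
arXiv:2007.07211, Lemma 6.5.3 (i) (same `V₀`), to which the counterexample family applies
verbatim; we make no further claim about that paper. As in the source (§4.2, Remark 6.1) the
frequency statements use the reduction to `a ≥ 0`.

## References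

* M. Dafermos, I. Rodnianski, Y. Shlapentokh-Rothman, arXiv:1402.7034 = Ann. of Math. 183 (2016):
  Def. 6.1.1, §6.4 (Lemmas 6.4.1, 6.4.2 and their proofs), §8.1 (the five ranges, Lemma 8.1.1 and
  its proof), §8.3 (Prop. 8.3.1, proof, first paragraph), §8.5 (proof of Prop. 8.5.1), §8.6
  (proof of Lemma 8.6.1, first display), §8.8 (key `DafermosRodnianskiShlapentokhrothman2014`).
-/

noncomputable section

namespace Literature.Geometry.Lorentzian

namespace Kerr

open Set

/-! ### Elementary facts: `r₊`, `ω₊`, and consequences of admissibility -/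

/-- `r₊ ≥ M` (`√(M² − a²) ≥ 0`). O'Neill 1995, §2.3. [folklore] -/
private theorem M_le_rPlus' (M a : ℝ) : M ≤ rPlus M a := by
  unfold rPlus; linarith [Real.sqrt_nonneg (M ^ 2 - a ^ 2)]

/-- `r₊ ≤ 2M` for `0 ≤ M`. [folklore] -/
private theorem rPlus_le_two_mul'' {M : ℝ} (hM : 0 ≤ M) (a : ℝ) : rPlus M a ≤ 2 * M := by
  have h1 : √(M ^ 2 - a ^ 2) ≤ √(M ^ 2) := Real.sqrt_le_sqrt (by nlinarith [sq_nonneg a])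
  rw [Real.sqrt_sq hM] at h1
  unfold rPlus; linarith

/-- `ω₊ m² = am²/(2Mr₊)`: the two spellings of the superradiant threshold (DRSR arXiv:1402.7034,
§2.2.2 and §6.4). [cite: DafermosRodnianskiShlapentokhrothman2014, §6.4] -/
theorem horizonAngularVelocity_mul_sq (M a : ℝ) (m : ℤ) :
    horizonAngularVelocity M a * (m : ℝ) ^ 2 = a * (m : ℝ) ^ 2 / (2 * M * rPlus M a) := by
  unfold horizonAngularVelocity; ring

/-- `ω₊ = a/(2Mr₊) ≥ 0` for `a ≥ 0`, `M ≥ 0` (the reduction to `a ≥ 0` of DRSR §4.2). [folklore] -/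
theorem horizonAngularVelocity_nonneg {M a : ℝ} (hM : 0 ≤ M) (ha0 : 0 ≤ a) :
    0 ≤ horizonAngularVelocity M a := by
  unfold horizonAngularVelocity
  exact div_nonneg ha0 (mul_nonneg (mul_nonneg zero_le_two hM) (hM.trans (M_le_rPlus' M a)))

/-- For an admissible triple, `|m| ≤ √Λ` (from `Λ ≥ m²`). DRSR arXiv:1402.7034, Def. 6.1.1.
[cite: DafermosRodnianskiShlapentokhrothman2014, Def. 6.1.1] -/
theorem IsAdmissibleTriple.abs_le_sqrt {a ω Λ : ℝ} {m : ℤ} (h : IsAdmissibleTriple a ω m Λ) :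
    |(m : ℝ)| ≤ √Λ :=
  Real.abs_le_sqrt h.sq_le

/-- For an admissible triple, `|m|√Λ ≤ Λ` — whence the repaired strip lies inside the printed one.
DRSR arXiv:1402.7034, Def. 6.1.1. [cite: DafermosRodnianskiShlapentokhrothman2014, Def. 6.1.1] -/
theorem IsAdmissibleTriple.abs_mul_sqrt_le {a ω Λ : ℝ} {m : ℤ} (h : IsAdmissibleTriple a ω m Λ) :
    |(m : ℝ)| * √Λ ≤ Λ :=
  calc |(m : ℝ)| * √Λ ≤ √Λ * √Λ := mul_le_mul_of_nonneg_right h.abs_le_sqrt (Real.sqrt_nonneg _)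
    _ = Λ := Real.mul_self_sqrt h.nonneg

/-- If `mω > 0` then `m ≠ 0`, so `|m| ≥ 1` (as a real number). [folklore] -/
theorem one_le_abs_of_mul_pos {ω : ℝ} {m : ℤ} (h : 0 < (m : ℝ) * ω) : 1 ≤ |(m : ℝ)| := by
  have hm : m ≠ 0 := by rintro rfl; simp at h
  rw [← Int.cast_abs]; exact_mod_cast Int.one_le_abs hm

/-- If `mω > 0` then `mω = |m| |ω|`. [folklore] -/
theorem mul_eq_abs_mul_abs_of_pos {ω : ℝ} {m : ℤ} (h : 0 < (m : ℝ) * ω) :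
    (m : ℝ) * ω = |(m : ℝ)| * |ω| := by
  rw [← abs_mul, abs_of_pos h]

/-- For an admissible triple with `mω > 0` (so `m ≠ 0`), `Λ ≥ 2`. DRSR arXiv:1402.7034, Def. 6.1.1
(`Λ ≥ |m|(|m| + 1)`). [cite: DafermosRodnianskiShlapentokhrothman2014, Def. 6.1.1] -/
theorem IsAdmissibleTriple.two_le {a ω Λ : ℝ} {m : ℤ} (h : IsAdmissibleTriple a ω m Λ)
    (hpos : 0 < (m : ℝ) * ω) : 2 ≤ Λ := by
  have h1 := one_le_abs_of_mul_pos hpos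
  have h2 := h.1
  have h3 : (1 : ℝ) * 2 ≤ |(m : ℝ)| * (|(m : ℝ)| + 1) :=
    mul_le_mul h1 (by linarith) (by norm_num) (abs_nonneg _)
  linarith

/-- Admissibility of the triples `(ω, 1, Λ)` used in the counterexamples below: `Λ ≥ 2` and
`Λ ≥ 2aω` (`a, ω ≥ 0`). DRSR arXiv:1402.7034, Def. 6.1.1. [cite: DafermosRodnianskiShlapentokhrothman2014, Def. 6.1.1] -/
private theorem isAdmissibleTriple_one {a ω Λ : ℝ} (ha0 : 0 ≤ a) (hω : 0 ≤ ω) (h2 : 2 ≤ Λ)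
    (haω : 2 * a * ω ≤ Λ) : IsAdmissibleTriple a ω (1 : ℤ) Λ := by
  constructor
  · simp only [Int.cast_one, abs_one]; linarith
  · simp only [Int.cast_one, mul_one]
    rw [abs_of_nonneg (mul_nonneg ha0 hω)]
    linarith

/-! ### The near-superradiant strips -/

/-- **The printed near-superradiant strip** `mω ∈ (0, am²/(2Mr₊) + αΛ]` of DRSR arXiv:1402.7034:
the hypothesis (withAlpha) of the `α`-clauses of Lemmas 6.4.1 and 6.4.2 and the strip entering the
definition of the ranges `𝓖^♯`, `𝓖_♯`, `𝓖_𝄬`, `𝓖_♮` of §8.1 (`ω₊ m² = am²/(2Mr₊)`,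
`horizonAngularVelocity_mul_sq`). For `α = 0` it is the superradiant regime
`ω(ω − ω₊m) < 0` up to the threshold (§6.4, with `a ≥ 0`). [cite: DafermosRodnianskiShlapentokhrothman2014, §8.1; Lemma 6.4.2] -/
def IsNearSuperradiant (M a α ω : ℝ) (m : ℤ) (Λ : ℝ) : Prop :=
  0 < (m : ℝ) * ω ∧ (m : ℝ) * ω ≤ horizonAngularVelocity M a * (m : ℝ) ^ 2 + α * Λ

/-- **The repaired near-superradiant strip** `mω ∈ (0, am²/(2Mr₊) + α|m|√Λ]`, i.e.
`0 < mω` and `|ω| − ω₊|m| ≤ α√Λ`: the widening of the superradiant regime for which the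
`α`-clauses of Lemmas 6.4.1/6.4.2 and Lemma 8.1.1 of DRSR arXiv:1402.7034 do hold (this file). Not
printed in the source; recorded as the correction of (withAlpha). [cite: DafermosRodnianskiShlapentokhrothman2014, Lemma 6.4.2 (corrected hypothesis)] -/
def IsNearSuperradiant' (M a α ω : ℝ) (m : ℤ) (Λ : ℝ) : Prop :=
  0 < (m : ℝ) * ω ∧ (m : ℝ) * ω ≤ horizonAngularVelocity M a * (m : ℝ) ^ 2 + α * (|(m : ℝ)| * √Λ)

/-- For admissible triples and `α ≥ 0` the repaired strip is contained in the printed one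
(`|m|√Λ ≤ Λ`). [cite: DafermosRodnianskiShlapentokhrothman2014, Def. 6.1.1] -/
theorem IsNearSuperradiant'.isNearSuperradiant {M a α ω Λ : ℝ} {m : ℤ}
    (h : IsNearSuperradiant' M a α ω m Λ) (hadm : IsAdmissibleTriple a ω m Λ) (hα : 0 ≤ α) :
    IsNearSuperradiant M a α ω m Λ :=
  ⟨h.1, h.2.trans (add_le_add le_rfl (mul_le_mul_of_nonneg_left hadm.abs_mul_sqrt_le hα))⟩

/-- The superradiant frequencies proper, `0 < mω ≤ ω₊m²` (DRSR arXiv:1402.7034, §6.4, with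
`a ≥ 0`), lie in the repaired strip for every `α ≥ 0`. [cite: DafermosRodnianskiShlapentokhrothman2014, §6.4] -/
theorem isNearSuperradiant'_of_superradiant {M a α ω Λ : ℝ} {m : ℤ} (hα : 0 ≤ α)
    (hpos : 0 < (m : ℝ) * ω) (hsr : (m : ℝ) * ω ≤ horizonAngularVelocity M a * (m : ℝ) ^ 2) :
    IsNearSuperradiant' M a α ω m Λ :=
  ⟨hpos, hsr.trans (le_add_of_nonneg_right (mul_nonneg hα (by positivity)))⟩

/-- The strip triples `(ω, 1, Λ)` of the counterexamples: `0 < ω ≤ αΛ` (and `ω₊ ≥ 0`).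
[cite: DafermosRodnianskiShlapentokhrothman2014, §8.1] -/
private theorem isNearSuperradiant_one {M a α ω Λ : ℝ} (hp : 0 ≤ horizonAngularVelocity M a)
    (hω : 0 < ω) (h : ω ≤ α * Λ) : IsNearSuperradiant M a α ω (1 : ℤ) Λ := by
  constructor
  · simp only [Int.cast_one, one_mul]; exact hω
  · simp only [Int.cast_one, one_mul, one_pow, mul_one]; linarith

/-- **The displayed implication of the proof of Lemma 8.1.1, for the repaired strip, with the
printed constant**: for `M ≥ 0`, `a ≥ 0` and an admissible triple in the repaired strip (any real
`α`; the source has `α > 0`), `ω² ≤ (ω₊ + α)² Λ` — indeed `|m||ω| = mω ≤ ω₊m² + α|m|√Λ` gives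
`|ω| ≤ ω₊|m| + α√Λ ≤ (ω₊ + α)√Λ`. (With `|ω| ≥ ω_high ≥ 0` this is the printed
`Λ ≥ (a/(2Mr₊) + α)⁻² ω_high²`.) DRSR arXiv:1402.7034, Lemma 8.1.1 (proof). [cite: DafermosRodnianskiShlapentokhrothman2014, Lemma 8.1.1 (proof)] -/
theorem sq_le_of_isNearSuperradiant' {M a α ω Λ : ℝ} {m : ℤ} (hM : 0 ≤ M) (ha0 : 0 ≤ a)
    (hadm : IsAdmissibleTriple a ω m Λ) (h : IsNearSuperradiant' M a α ω m Λ) :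
    ω ^ 2 ≤ (horizonAngularVelocity M a + α) ^ 2 * Λ := by
  obtain ⟨hpos, hle⟩ := h
  set p := horizonAngularVelocity M a with hp_def
  have hp : 0 ≤ p := horizonAngularVelocity_nonneg hM ha0
  set q := |(m : ℝ)| with hq_def
  set s := √Λ with hs_def
  have hq1 : 1 ≤ q := one_le_abs_of_mul_pos hpos
  have hqs : q ≤ s := hadm.abs_le_sqrt
  have hs : s ^ 2 = Λ := Real.sq_sqrt hadm.nonneg
  have hx : (m : ℝ) * ω = q * |ω| := mul_eq_abs_mul_abs_of_pos hpos
  have hm2 : (m : ℝ) ^ 2 = q ^ 2 := (sq_abs _).symm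
  rw [hx, hm2] at hle
  -- `q |ω| ≤ p q² + α q s`, divide by `q > 0`
  have h1 : |ω| ≤ p * q + α * s := by
    have hq0 : 0 < q := by linarith
    have : q * |ω| ≤ q * (p * q + α * s) := by linarith
    exact le_of_mul_le_mul_left this hq0
  have h2 : |ω| ≤ (p + α) * s := by linarith [mul_le_mul_of_nonneg_left hqs hp]
  have h3 : |ω| ^ 2 ≤ ((p + α) * s) ^ 2 := pow_le_pow_left₀ (abs_nonneg ω) h2 2
  calc ω ^ 2 = |ω| ^ 2 := (sq_abs ω).symm
    _ ≤ ((p + α) * s) ^ 2 := h3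
    _ = (p + α) ^ 2 * Λ := by rw [mul_pow, hs]

/-! ### The five frequency ranges of §8.1 -/

section Ranges

variable (S : ℝ → ℤ → ℝ → Prop)

/-- **The range `𝓖^♯(ω_high)`** ("large frequency superradiant regime") of DRSR arXiv:1402.7034,
§8.1: admissible triples with `Λ ≥ (a/(2Mr₊) + α)⁻² ω_high²` — written multiplied out as
`ω_high² ≤ (ω₊ + α)² Λ` (`isFreqSharpSup_threshold_iff`) — lying in the near-superradiant strip
`S` (`S = IsNearSuperradiant M a α` as printed, `S = IsNearSuperradiant' M a α` repaired).
[cite: DafermosRodnianskiShlapentokhrothman2014, §8.1] -/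
def IsFreqSharpSup (M a α ωh : ℝ) (ω : ℝ) (m : ℤ) (Λ : ℝ) : Prop :=
  IsAdmissibleTriple a ω m Λ ∧ ωh ^ 2 ≤ (horizonAngularVelocity M a + α) ^ 2 * Λ ∧ S ω m Λ

/-- **The range `𝓖_♯(ω_high, ε_width)`** ("time frequencies dominate") of DRSR arXiv:1402.7034,
§8.1: admissible, `|ω| ≥ ω_high`, `Λ < ε_width ω²`, off the strip `S`.
[cite: DafermosRodnianskiShlapentokhrothman2014, §8.1] -/
def IsFreqSharpSub (a ωh ε : ℝ) (ω : ℝ) (m : ℤ) (Λ : ℝ) : Prop :=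
  IsAdmissibleTriple a ω m Λ ∧ ωh ≤ |ω| ∧ Λ < ε * ω ^ 2 ∧ ¬ S ω m Λ

/-- **The range `𝓖_𝄬(ω_high, ε_width)`** ("angular frequencies dominate") of DRSR
arXiv:1402.7034, §8.1: admissible, `Λ ≥ ε_width⁻¹ ω_high²`, `ε_width Λ > ω²`, off the strip `S`.
[cite: DafermosRodnianskiShlapentokhrothman2014, §8.1] -/
def IsFreqLessflat (a ωh ε : ℝ) (ω : ℝ) (m : ℤ) (Λ : ℝ) : Prop :=
  IsAdmissibleTriple a ω m Λ ∧ ε⁻¹ * ωh ^ 2 ≤ Λ ∧ ω ^ 2 < ε * Λ ∧ ¬ S ω m Λ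

/-- **The range `𝓖_♮(ω_high, ε_width)`** (the trapping regime: `ω²` and `Λ` large and
comparable) of DRSR arXiv:1402.7034, §8.1: admissible, `|ω| ≥ ω_high`,
`ε_width Λ ≤ ω² ≤ ε_width⁻¹ Λ`, off the strip `S`. [cite: DafermosRodnianskiShlapentokhrothman2014, §8.1] -/
def IsFreqNatural (a ωh ε : ℝ) (ω : ℝ) (m : ℤ) (Λ : ℝ) : Prop :=
  IsAdmissibleTriple a ω m Λ ∧ ωh ≤ |ω| ∧ ε * Λ ≤ ω ^ 2 ∧ ω ^ 2 ≤ ε⁻¹ * Λ ∧ ¬ S ω m Λ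

/-- **The range `𝓖_♭(ω_high, ε_width)`** (bounded frequencies) of DRSR arXiv:1402.7034, §8.1:
admissible, `|ω| < ω_high`, `Λ < ε_width⁻¹ ω_high²` (no strip condition).
[cite: DafermosRodnianskiShlapentokhrothman2014, §8.1] -/
def IsFreqFlat (a ωh ε : ℝ) (ω : ℝ) (m : ℤ) (Λ : ℝ) : Prop :=
  IsAdmissibleTriple a ω m Λ ∧ |ω| < ωh ∧ Λ < ε⁻¹ * ωh ^ 2

/-- The multiplied-out threshold of `𝓖^♯` is the printed one, `(ω₊ + α)⁻² ω_high² ≤ Λ`, whenever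
`ω₊ + α ≠ 0` (in the source `α > 0`, `a ≥ 0`). DRSR arXiv:1402.7034, §8.1. [cite: DafermosRodnianskiShlapentokhrothman2014, §8.1] -/
theorem isFreqSharpSup_threshold_iff {M a α : ℝ} (h : horizonAngularVelocity M a + α ≠ 0)
    (ωh Λ : ℝ) :
    ωh ^ 2 ≤ (horizonAngularVelocity M a + α) ^ 2 * Λ ↔
      ((horizonAngularVelocity M a + α) ^ 2)⁻¹ * ωh ^ 2 ≤ Λ := by
  have hc : 0 < (horizonAngularVelocity M a + α) ^ 2 :=
    lt_of_le_of_ne (sq_nonneg _) (pow_ne_zero 2 h).symm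
  rw [inv_mul_le_iff₀ hc]

end Ranges

/-! ### Lemma 8.1.1 as printed fails: the printed ranges do not cover the admissible triples -/

/-- **Counterexample to DRSR Lemma 8.1.1 as printed.** Let `M > 0`, `a ≥ 0`, `α > 0` and let
`ε` be arbitrary. Then for all sufficiently large `ω_high` there is an admissible triple lying in
**none** of the five printed ranges `𝓖^♯(ω_high)`, `𝓖_♯`, `𝓖_𝄬`, `𝓖_♮`, `𝓖_♭(ω_high, ε)`:
`ω = ω_high`, `m = 1`, `Λ = max(2, ω_high/α, 2aω_high)` is admissible, lies in the printed strip
(`ω_high ≤ ω₊ + αΛ`), so it is not in `𝓖_♯ ∪ 𝓖_𝄬 ∪ 𝓖_♮`; `|ω| = ω_high` excludes `𝓖_♭`; and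
`(ω₊ + α)² Λ ≤ (ω₊ + α)²(2 + 1/α + 2a) ω_high < ω_high²` excludes `𝓖^♯`. In particular the
displayed implication of the printed proof fails. (Explicit threshold:
`ω_high ≥ max(1, (1/α + 2a + 2)(ω₊ + α)² + 1)`.) The source asserts the contrary: "if
`(ω, m, Λ)` is admissible, then, for all choices of parameters `ω_high`, `ε_width`, `(ω, m, Λ)`
lies in exactly one of the frequency ranges". [cite: DafermosRodnianskiShlapentokhrothman2014, Lemma 8.1.1 (fails as printed)] -/
theorem exists_admissible_not_mem_freqRanges_printed {M a α : ℝ} (hM : 0 < M) (ha0 : 0 ≤ a)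
    (hα : 0 < α) (ε : ℝ) :
    ∃ ω₀ : ℝ, ∀ ωh : ℝ, ω₀ ≤ ωh → ∃ (ω : ℝ) (m : ℤ) (Λ : ℝ), IsAdmissibleTriple a ω m Λ ∧
      ¬ IsFreqSharpSup (IsNearSuperradiant M a α) M a α ωh ω m Λ ∧
      ¬ IsFreqSharpSub (IsNearSuperradiant M a α) a ωh ε ω m Λ ∧
      ¬ IsFreqLessflat (IsNearSuperradiant M a α) a ωh ε ω m Λ ∧
      ¬ IsFreqNatural (IsNearSuperradiant M a α) a ωh ε ω m Λ ∧
      ¬ IsFreqFlat a ωh ε ω m Λ := by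
  have hp : 0 ≤ horizonAngularVelocity M a := horizonAngularVelocity_nonneg hM.le ha0
  have hK : 0 < (horizonAngularVelocity M a + α) ^ 2 := pow_pos (add_pos_of_nonneg_of_pos hp hα) 2
  refine ⟨max 1 ((1 / α + 2 * a + 2) * (horizonAngularVelocity M a + α) ^ 2 + 1),
    fun ωh hωh ↦ ?_⟩
  have hω1 : 1 ≤ ωh := le_trans (le_max_left _ _) hωh
  have hωK : (1 / α + 2 * a + 2) * (horizonAngularVelocity M a + α) ^ 2 + 1 ≤ ωh :=
    le_trans (le_max_right _ _) hωh
  have hω0 : 0 < ωh := by linarith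
  set Λ := max (max 2 (ωh / α)) (2 * a * ωh) with hΛ_def
  have hΛ2 : 2 ≤ Λ := le_trans (le_max_left _ _) (le_max_left _ _)
  have hΛα : ωh / α ≤ Λ := le_trans (le_max_right _ _) (le_max_left _ _)
  have hΛa : 2 * a * ωh ≤ Λ := le_max_right _ _
  have hΛle : Λ ≤ 2 + ωh / α + 2 * a * ωh := by
    have h1 : 0 ≤ ωh / α := by positivity
    have h2 : 0 ≤ 2 * a * ωh := by positivity
    exact max_le (max_le (by linarith) (by linarith)) (by linarith)
  -- the strip condition `ωh ≤ ω₊ + α Λ` and admissibility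
  have hαΛ : ωh ≤ α * Λ := by
    have := (div_le_iff₀ hα).1 hΛα
    linarith
  have hstrip : IsNearSuperradiant M a α ωh (1 : ℤ) Λ := isNearSuperradiant_one hp hω0 hαΛ
  have hadm : IsAdmissibleTriple a ωh (1 : ℤ) Λ := isAdmissibleTriple_one ha0 hω0.le hΛ2 hΛa
  refine ⟨ωh, 1, Λ, hadm, ?_, ?_, ?_, ?_, ?_⟩
  · -- not in `𝓖^♯`: `(ω₊ + α)² Λ < ωh²`
    rintro ⟨-, hle, -⟩
    have h1 : (horizonAngularVelocity M a + α) ^ 2 * Λ ≤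
        (horizonAngularVelocity M a + α) ^ 2 * (2 + ωh / α + 2 * a * ωh) :=
      mul_le_mul_of_nonneg_left hΛle hK.le
    have h2 : (horizonAngularVelocity M a + α) ^ 2 * (2 + ωh / α + 2 * a * ωh) ≤
        (horizonAngularVelocity M a + α) ^ 2 * ((1 / α + 2 * a + 2) * ωh) := by
      apply mul_le_mul_of_nonneg_left _ hK.le
      have : ωh / α = (1 / α) * ωh := by ring
      rw [this]; linarith
    have h3 : (horizonAngularVelocity M a + α) ^ 2 * ((1 / α + 2 * a + 2) * ωh) < ωh * ωh := by
      have h4 : (1 / α + 2 * a + 2) * (horizonAngularVelocity M a + α) ^ 2 < ωh := by linarith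
      have h5 := mul_lt_mul_of_pos_right h4 hω0
      have e : (horizonAngularVelocity M a + α) ^ 2 * ((1 / α + 2 * a + 2) * ωh) =
          (1 / α + 2 * a + 2) * (horizonAngularVelocity M a + α) ^ 2 * ωh := by ring
      rw [e]; exact h5
    linarith
  · rintro ⟨-, -, -, hS⟩; exact hS hstrip
  · rintro ⟨-, -, -, hS⟩; exact hS hstrip
  · rintro ⟨-, -, -, -, hS⟩; exact hS hstrip
  · rintro ⟨-, hlt, -⟩
    rw [abs_of_nonneg hω0.le] at hlt
    exact lt_irrefl _ hlt

/-! ### Lemma 6.4.2, `α`-clause as printed, fails for every `α > 0` -/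

/-- A crude bound: for `0 < M`, `0 ≤ a`, `m = 1`, `ω = t ≥ 0`, `Λ ≥ 2at` and `r ≥ r₊` (so
`r ≥ M`), `V₀(r) ≤ 3Λ/M²` (`ΔΛ ≤ (r² + a²)Λ`, `4Mrat ≤ 2MrΛ`, `r² + a² ≥ M²`, `M³r ≤ (r² + a²)²`).
Used for the counterexample to the printed `α`-clause of Lemma 6.4.2. [folklore] -/
private theorem sepPotential₀_one_le {M a t Λ r : ℝ} (hM : 0 < M) (ha0 : 0 ≤ a) (ht : 0 ≤ t)
    (hΛ : 2 * a * t ≤ Λ) (hr : rPlus M a ≤ r) :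
    sepPotential₀ M a t (1 : ℤ) Λ r ≤ 3 * Λ / M ^ 2 := by
  have hrM : M ≤ r := (M_le_rPlus' M a).trans hr
  have hr0 : 0 < r := hM.trans_le hrM
  have hΛ0 : 0 ≤ Λ := le_trans (by positivity) hΛ
  have hA : M ^ 2 ≤ r ^ 2 + a ^ 2 := by linarith [pow_le_pow_left₀ hM.le hrM 2, sq_nonneg a]
  have hA0 : 0 < (r ^ 2 + a ^ 2) ^ 2 := by positivity
  have h1 : 4 * M * r * a * t ≤ 2 * M * r * Λ := by
    have : 4 * M * r * a * t = 2 * M * r * (2 * a * t) := by ring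
    rw [this]; exact mul_le_mul_of_nonneg_left hΛ (by positivity)
  have h2 : (r ^ 2 - 2 * M * r + a ^ 2) * Λ ≤ (r ^ 2 + a ^ 2) * Λ :=
    mul_le_mul_of_nonneg_right (by linarith [mul_pos hM hr0]) hΛ0
  have h3 : M ^ 3 * r ≤ (r ^ 2 + a ^ 2) ^ 2 := by
    have h' : M ^ 3 ≤ r ^ 3 := pow_le_pow_left₀ hM.le hrM 3
    have h'' : M ^ 3 * r ≤ r ^ 3 * r := mul_le_mul_of_nonneg_right h' hr0.le
    linarith [mul_nonneg (sq_nonneg r) (sq_nonneg a), sq_nonneg (a ^ 2)]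
  have h4 : M ^ 2 * (r ^ 2 + a ^ 2) ≤ (r ^ 2 + a ^ 2) ^ 2 := by
    have := mul_le_mul_of_nonneg_right hA (by positivity : (0 : ℝ) ≤ r ^ 2 + a ^ 2)
    linarith
  have e1 : 2 * M * r * Λ * M ^ 2 ≤ 2 * Λ * (r ^ 2 + a ^ 2) ^ 2 := by
    linarith [mul_le_mul_of_nonneg_left h3 hΛ0]
  have e2 : (r ^ 2 + a ^ 2) * Λ * M ^ 2 ≤ Λ * (r ^ 2 + a ^ 2) ^ 2 := by
    linarith [mul_le_mul_of_nonneg_left h4 hΛ0]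
  have e3 := mul_le_mul_of_nonneg_right h1 (sq_nonneg M)
  have e4 := mul_le_mul_of_nonneg_right h2 (sq_nonneg M)
  have e5 : 0 ≤ a ^ 2 * M ^ 2 := by positivity
  unfold sepPotential₀ delta
  rw [div_le_div_iff₀ hA0 (by positivity)]
  push_cast
  linarith [e1, e2, e3, e4, e5]

/-- **Counterexample to the `α`-clause of DRSR Lemma 6.4.2 as printed.** For `0 < M`, `0 ≤ a`
and **every** `α > 0` there is an admissible triple in the printed strip
`0 < mω ≤ am²/(2Mr₊) + αΛ`, with `Λ > 0`, such that `V₀(r) − ω² ≤ −Λ` for all `r ≥ r₊` — so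
`V₀` stays below the energy level `ω²` on the whole exterior, by a margin `Λ`: namely `m = 1`,
`ω = t = max(1, t₀, (3/M² + 1)(2 + 1/α + 2a))`, `Λ = max(2, t/α, 2at)` (`V₀ ≤ 3Λ/M²` on `r ≥ r₊`
while `ω² = t² ≥ (3/M² + 1)Λ`); here `t₀` is a free lower bound for `ω` (and `Λ ≥ ω/α`), used
below to place the triple in `𝓖^♯(ω_high)`. The source asserts: "For all `α ≥ 0` sufficiently
small, then for all admissible frequency triples satisfying in addition
`0 < mω ≤ am²/(2Mr₊) + αΛ`, the potential `V₀` satisfies `bΛ ≤ V₀(r⁰_max) − ω²`", with the proof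
"it suffices to prove the lemma with `α = 0`".
[cite: DafermosRodnianskiShlapentokhrothman2014, Lemma 6.4.2 (α-clause, fails as printed)] -/
theorem exists_isNearSuperradiant_sepPotential₀_sub_sq_le {M a α : ℝ} (hM : 0 < M) (ha0 : 0 ≤ a)
    (hα : 0 < α) (t₀ : ℝ) :
    ∃ (ω : ℝ) (m : ℤ) (Λ : ℝ), IsAdmissibleTriple a ω m Λ ∧ IsNearSuperradiant M a α ω m Λ ∧
      0 < Λ ∧ t₀ ≤ ω ∧ ω / α ≤ Λ ∧
      ∀ r, rPlus M a ≤ r → sepPotential₀ M a ω m Λ r - ω ^ 2 ≤ -Λ := by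
  have hp : 0 ≤ horizonAngularVelocity M a := horizonAngularVelocity_nonneg hM.le ha0
  set c := 3 / M ^ 2 + 1 with hc_def
  have hc : 0 < c := by positivity
  set t := max (max 1 t₀) (c * (2 + 1 / α + 2 * a)) with ht_def
  have ht1 : 1 ≤ t := le_trans (le_max_left _ _) (le_max_left _ _)
  have ht₀ : t₀ ≤ t := le_trans (le_max_right _ _) (le_max_left _ _)
  have ht0 : 0 < t := by linarith
  have htc : c * (2 + 1 / α + 2 * a) ≤ t := le_max_right _ _
  set Λ := max (max 2 (t / α)) (2 * a * t) with hΛ_def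
  have hΛ2 : 2 ≤ Λ := le_trans (le_max_left _ _) (le_max_left _ _)
  have hΛα : t / α ≤ Λ := le_trans (le_max_right _ _) (le_max_left _ _)
  have hΛa : 2 * a * t ≤ Λ := le_max_right _ _
  have hΛ0 : 0 < Λ := by linarith
  have hΛle : Λ ≤ 2 + t / α + 2 * a * t := by
    have h1 : 0 ≤ t / α := by positivity
    have h2 : 0 ≤ 2 * a * t := by positivity
    exact max_le (max_le (by linarith) (by linarith)) (by linarith)
  have hαΛ : t ≤ α * Λ := by
    have := (div_le_iff₀ hα).1 hΛα
    linarith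
  refine ⟨t, 1, Λ, isAdmissibleTriple_one ha0 ht0.le hΛ2 hΛa, isNearSuperradiant_one hp ht0 hαΛ,
    hΛ0, ht₀, hΛα, fun r hr ↦ ?_⟩
  have hV := sepPotential₀_one_le hM ha0 ht0.le hΛa hr
  -- `ω² = t² ≥ c Λ = 3Λ/M² + Λ`
  have h1 : c * Λ ≤ c * (t * (2 + 1 / α + 2 * a)) := by
    apply mul_le_mul_of_nonneg_left _ hc.le
    have : t / α = t * (1 / α) := by ring
    rw [this] at hΛle
    linarith
  have h2 : c * (t * (2 + 1 / α + 2 * a)) ≤ t * t := by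
    have : c * (t * (2 + 1 / α + 2 * a)) = (c * (2 + 1 / α + 2 * a)) * t := by ring
    rw [this]
    exact mul_le_mul_of_nonneg_right htc ht0.le
  have h3 : c * Λ = 3 * Λ / M ^ 2 + Λ := by rw [hc_def]; ring
  linarith

/-- **The printed `α`-clause of Lemma 6.4.2 is false, in its weakest located form**: for `0 < M`,
`0 ≤ a`, every `α > 0` and every `b ≥ 0` it is *not* the case that every admissible triple in the
printed strip admits some `r > r₊` with `bΛ ≤ V₀(r) − ω²` (let alone at `r⁰_max`).
[cite: DafermosRodnianskiShlapentokhrothman2014, Lemma 6.4.2 (α-clause, fails as printed)] -/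
theorem not_lemma_6_4_2_alpha_printed {M a α b : ℝ} (hM : 0 < M) (ha0 : 0 ≤ a) (hα : 0 < α)
    (hb : 0 ≤ b) :
    ¬ ∀ (ω : ℝ) (m : ℤ) (Λ : ℝ), IsAdmissibleTriple a ω m Λ → IsNearSuperradiant M a α ω m Λ →
        ∃ r, rPlus M a < r ∧ b * Λ ≤ sepPotential₀ M a ω m Λ r - ω ^ 2 := by
  intro H
  obtain ⟨ω, m, Λ, hadm, hstrip, hΛ, -, -, hV⟩ :=
    exists_isNearSuperradiant_sepPotential₀_sub_sq_le hM ha0 hα 0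
  obtain ⟨r, hr, hbr⟩ := H ω m Λ hadm hstrip
  have h1 := hV r hr.le
  have h2 : 0 ≤ b * Λ := mul_nonneg hb hΛ.le
  linarith

/-- **The gap this opens in the proof of Prop. 8.3.1 (the printed range `𝓖^♯`).** For `0 < M`,
`0 ≤ a`, every `α > 0` and **every** `ω_high`, the printed range `𝓖^♯(ω_high)` contains an
admissible triple with `V₀(r) − ω² ≤ −Λ < 0` for all `r ≥ r₊` (the triple of
`exists_isNearSuperradiant_sepPotential₀_sub_sq_le` with `ω ≥ αω_high²/(ω₊ + α)²`, so that
`Λ ≥ ω/α ≥ (ω₊ + α)⁻²ω_high²`). The proof of Prop. 8.3.1 begins: "As `𝓖^♯` is a superradiant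
regime with `Λ > 0`, the conclusions of both Lemma 6.4.1 and Lemma 6.4.2 apply. In particular, the
potential `V₀` has a unique `r⁰_max` which is a maximum, and satisfies `V₀(r⁰_max) − ω² ≥ cΛ`" — which
fails for this triple, whatever `ω_high`. [cite: DafermosRodnianskiShlapentokhrothman2014, Prop. 8.3.1 (proof, first paragraph; fails for the printed range)] -/
theorem exists_isFreqSharpSup_printed_sepPotential₀_sub_sq_le {M a α : ℝ} (hM : 0 < M)
    (ha0 : 0 ≤ a) (hα : 0 < α) (ωh : ℝ) :
    ∃ (ω : ℝ) (m : ℤ) (Λ : ℝ), IsFreqSharpSup (IsNearSuperradiant M a α) M a α ωh ω m Λ ∧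
      0 < Λ ∧ ∀ r, rPlus M a ≤ r → sepPotential₀ M a ω m Λ r - ω ^ 2 ≤ -Λ := by
  have hp : 0 ≤ horizonAngularVelocity M a := horizonAngularVelocity_nonneg hM.le ha0
  have hC : 0 < horizonAngularVelocity M a + α := add_pos_of_nonneg_of_pos hp hα
  have hK : 0 < (horizonAngularVelocity M a + α) ^ 2 := pow_pos hC 2
  obtain ⟨ω, m, Λ, hadm, hstrip, hΛ, hω, hωΛ, hV⟩ :=
    exists_isNearSuperradiant_sepPotential₀_sub_sq_le hM ha0 hα
      (α * ωh ^ 2 / (horizonAngularVelocity M a + α) ^ 2)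
  refine ⟨ω, m, Λ, ⟨hadm, ?_, hstrip⟩, hΛ, hV⟩
  -- `ωh² ≤ (ω₊ + α)² Λ` from `Λ ≥ ω/α ≥ ωh²/(ω₊ + α)²`
  have h1 : ω ≤ α * Λ := by
    have := (div_le_iff₀ hα).1 hωΛ
    linarith
  have h2 : α * ωh ^ 2 ≤ (horizonAngularVelocity M a + α) ^ 2 * ω := by
    have := (div_le_iff₀ hK).1 hω
    linarith
  have h3 : (horizonAngularVelocity M a + α) ^ 2 * ω ≤
      (horizonAngularVelocity M a + α) ^ 2 * (α * Λ) := mul_le_mul_of_nonneg_left h1 hK.le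
  have h4 : α * ωh ^ 2 ≤ α * ((horizonAngularVelocity M a + α) ^ 2 * Λ) := by linarith
  exact le_of_mul_le_mul_left h4 hα

/-! ### The repaired strip: Lemma 8.1.1 (coverage) -/

/-- **DRSR Lemma 8.1.1, repaired (coverage of the admissible triples).** Let `M ≥ 0`, `a ≥ 0`,
`ω_high ≥ 0`, `0 < ε_width ≤ (ω₊ + α)²` (the source takes `ε_width` small; `α` is any real, in the
source `α > 0`). Then every
admissible triple lies in (at least) one of the five ranges of §8.1 **built on the repaired strip**
`0 < mω ≤ ω₊m² + α|m|√Λ`: on the strip, `|ω| ≥ ω_high` gives `𝓖^♯` by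
`sq_le_of_isNearSuperradiant'` (the printed implication with the printed constant), `|ω| < ω_high`
gives `𝓖_♭` or, if `Λ ≥ ε_width⁻¹ω_high²`, again `𝓖^♯` since `ε_width ≤ (ω₊ + α)²`; off the strip
the printed case analysis applies (`Λ < ε_width ω²` / `ε_width Λ ≤ ω² ≤ ε_width⁻¹Λ` /
`ω² < ε_width Λ`, resp. `|ω| < ω_high`). As printed: "every admissible frequency triple `(ω, m, Λ)`
lies in exactly one of the frequency ranges" (Lemma 8.1.1, §8.8); uniqueness is not formalised
(unused, and `𝓖^♯ ∩ 𝓖_♭ ≠ ∅` is possible as printed). [cite: DafermosRodnianskiShlapentokhrothman2014, Lemma 8.1.1 (repaired strip)] -/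
theorem freqRanges'_cover {M a α ωh ε ω Λ : ℝ} {m : ℤ} (hM : 0 ≤ M) (ha0 : 0 ≤ a)
    (hωh : 0 ≤ ωh) (hε : 0 < ε) (hεC : ε ≤ (horizonAngularVelocity M a + α) ^ 2)
    (hadm : IsAdmissibleTriple a ω m Λ) :
    IsFreqSharpSup (IsNearSuperradiant' M a α) M a α ωh ω m Λ ∨
      IsFreqSharpSub (IsNearSuperradiant' M a α) a ωh ε ω m Λ ∨
      IsFreqLessflat (IsNearSuperradiant' M a α) a ωh ε ω m Λ ∨
      IsFreqNatural (IsNearSuperradiant' M a α) a ωh ε ω m Λ ∨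
      IsFreqFlat a ωh ε ω m Λ := by
  have hΛ := hadm.nonneg
  have hε0 : ε ≠ 0 := hε.ne'
  have hεi : 0 ≤ ε⁻¹ := inv_nonneg.2 hε.le
  have eq1 : ∀ x : ℝ, ε * (ε⁻¹ * x) = x := fun x ↦ by
    rw [← mul_assoc, mul_inv_cancel₀ hε0, one_mul]
  have eq2 : ∀ x : ℝ, ε⁻¹ * (ε * x) = x := fun x ↦ by
    rw [← mul_assoc, inv_mul_cancel₀ hε0, one_mul]
  by_cases hS : IsNearSuperradiant' M a α ω m Λ
  · by_cases hω : ωh ≤ |ω|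
    · left
      refine ⟨hadm, ?_, hS⟩
      have h1 : ωh ^ 2 ≤ ω ^ 2 := by
        have := pow_le_pow_left₀ hωh hω 2
        rwa [sq_abs] at this
      exact h1.trans (sq_le_of_isNearSuperradiant' hM ha0 hadm hS)
    · push Not at hω
      by_cases hΛ' : Λ < ε⁻¹ * ωh ^ 2
      · right; right; right; right; exact ⟨hadm, hω, hΛ'⟩
      · left
        push Not at hΛ'
        refine ⟨hadm, ?_, hS⟩
        have h1 : ωh ^ 2 ≤ ε * Λ := by
          calc ωh ^ 2 = ε * (ε⁻¹ * ωh ^ 2) := (eq1 _).symm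
            _ ≤ ε * Λ := mul_le_mul_of_nonneg_left hΛ' hε.le
        exact h1.trans (mul_le_mul_of_nonneg_right hεC hΛ)
  · by_cases hω : ωh ≤ |ω|
    · by_cases h1 : Λ < ε * ω ^ 2
      · right; left; exact ⟨hadm, hω, h1, hS⟩
      · push Not at h1
        by_cases h2 : ε * Λ ≤ ω ^ 2
        · right; right; right; left
          refine ⟨hadm, hω, h2, ?_, hS⟩
          calc ω ^ 2 = ε⁻¹ * (ε * ω ^ 2) := (eq2 _).symm
            _ ≤ ε⁻¹ * Λ := mul_le_mul_of_nonneg_left h1 hεi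
        · push Not at h2
          right; right; left
          refine ⟨hadm, ?_, h2, hS⟩
          have h3 : ωh ^ 2 ≤ ω ^ 2 := by
            have := pow_le_pow_left₀ hωh hω 2
            rwa [sq_abs] at this
          calc ε⁻¹ * ωh ^ 2 ≤ ε⁻¹ * ω ^ 2 := mul_le_mul_of_nonneg_left h3 hεi
            _ ≤ ε⁻¹ * (ε * Λ) := mul_le_mul_of_nonneg_left h2.le hεi
            _ = Λ := eq2 _
    · push Not at hω
      by_cases hΛ' : Λ < ε⁻¹ * ωh ^ 2
      · right; right; right; right; exact ⟨hadm, hω, hΛ'⟩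
      · push Not at hΛ'
        right; right; left
        refine ⟨hadm, hΛ', ?_, hS⟩
        have h3 : ω ^ 2 < ωh ^ 2 := by
          rw [← sq_abs ω]
          exact pow_lt_pow_left₀ hω (abs_nonneg ω) two_ne_zero
        have h4 : ωh ^ 2 ≤ ε * Λ := by
          calc ωh ^ 2 = ε * (ε⁻¹ * ωh ^ 2) := (eq1 _).symm
            _ ≤ ε * Λ := mul_le_mul_of_nonneg_left hΛ' hε.le
        exact h3.trans_le h4

/-! ### The repaired strip: Lemma 6.4.1 and Lemma 6.4.2, `α`-clauses -/

/-- **DRSR Lemma 6.4.1, `α`-clause, for the repaired strip**, with the explicit constant of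
`le_deriv_sepPotential₀_rPlus_alpha`: for `0 < M`, `0 ≤ a < M`, an admissible triple, `α ≥ 0` and
`mω ≤ am²/(2Mr₊) + α|m|√Λ`,
`dV₀/dr(r₊) ≥ (4(r₊ − M)(Mr₊ − a²) − 4aMα(3r₊² − a²)) Λ/(r₊² + a²)³` (since `|m|√Λ ≤ Λ`, the
hypothesis implies the printed one). [cite: DafermosRodnianskiShlapentokhrothman2014, Lemma 6.4.1] -/
theorem le_deriv_sepPotential₀_rPlus_alpha' {M a ω Λ α : ℝ} {m : ℤ} (hM : 0 < M) (ha0 : 0 ≤ a)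
    (haM : a < M) (hadm : IsAdmissibleTriple a ω m Λ) (hα : 0 ≤ α)
    (hsr : m * ω ≤ a * (m : ℝ) ^ 2 / (2 * M * rPlus M a) + α * (|(m : ℝ)| * √Λ)) :
    (4 * (rPlus M a - M) * (M * rPlus M a - a ^ 2) -
        4 * a * M * α * (3 * rPlus M a ^ 2 - a ^ 2)) * Λ / (rPlus M a ^ 2 + a ^ 2) ^ 3 ≤
      deriv (sepPotential₀ M a ω m Λ) (rPlus M a) :=
  le_deriv_sepPotential₀_rPlus_alpha hM ha0 haM hadm hα
    (hsr.trans (add_le_add le_rfl (mul_le_mul_of_nonneg_left hadm.abs_mul_sqrt_le hα)))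

/-- `V₀` is nondecreasing in `ω` in the direction of `m`: if `mω₀ ≤ mω` then
`V₀(ω₀)(r) ≤ V₀(ω)(r)` for `r ≥ 0`, `a ≥ 0`, `M ≥ 0` (the only `ω`-dependence of `V₀` is the term
`4Mra·mω/(r² + a²)²`). DRSR arXiv:1402.7034, §6.2 (the formula for `V₀`). [cite: DafermosRodnianskiShlapentokhrothman2014, §6.2] -/
theorem sepPotential₀_mono_omega {M a ω₀ ω Λ r : ℝ} {m : ℤ} (hM : 0 ≤ M) (ha0 : 0 ≤ a)
    (hr : 0 ≤ r) (h : (m : ℝ) * ω₀ ≤ (m : ℝ) * ω) :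
    sepPotential₀ M a ω₀ m Λ r ≤ sepPotential₀ M a ω m Λ r := by
  unfold sepPotential₀
  apply div_le_div_of_nonneg_right ?_ (by positivity)
  have e : ∀ x : ℝ, 4 * M * r * a * (m : ℝ) * x = (4 * M * r * a) * ((m : ℝ) * x) :=
    fun x ↦ by ring
  rw [e, e]
  have := mul_le_mul_of_nonneg_left h (by positivity : 0 ≤ 4 * M * r * a)
  linarith

/-- **DRSR Lemma 6.4.2 (with Lemma 6.4.1), `α`-clause, for the repaired strip — proved.** For
`0 < M`, `0 ≤ a < M` there are explicit `α₀ > 0` and `b > 0` (depending on `M`, `a`) such that for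
all `0 ≤ α ≤ α₀` and every admissible triple with `0 < mω ≤ am²/(2Mr₊) + α|m|√Λ`, the potential
`V₀` has a unique critical point `r⁰_max ∈ (r₊, 7M)` on `(r₊, ∞)`, which is its global maximum there,
and `V₀(r⁰_max) − ω² ≥ bΛ` ("the maximum of `V` is always (quantitatively) above the energy level
`ω²`"). Constants: with `b₀` from the `α = 0` case (`exists_sepPotential₀_sub_sq_ge`),
`B₀ = 4(r₊ − M)(Mr₊ − a²)`, `D = 4aM(3r₊² − a²)`, `ω₊ = a/(2Mr₊)`:
`α₀ = min(1, b₀/(2(2ω₊ + 1)), B₀/(2(D + 1)), 2/(17M))`, `b = min(b₀/2, 4/(289M²))`. Proof: case (b)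
of Lemma 6.3.1 by Lemma 6.4.1 (`sepPotential₀_caseB_of_superradiant`); if `mω ≤ ω₊m²` the `α = 0`
lemma; otherwise, for `a > 0`, the threshold triple `(ω₊m, m, Λ)` is admissible and superradiant,
`V₀(ω) ≥ V₀(ω₊m)` pointwise (`sepPotential₀_mono_omega`) and
`ω² − ω₊²m² = (|ω| − ω₊|m|)(|ω| + ω₊|m|) ≤ α√Λ(2ω₊|m| + α√Λ) ≤ (2ω₊α + α²)Λ ≤ b₀Λ/2`; for `a = 0`,
`|ω| ≤ α√Λ` and `V₀(4M) ≥ 8Λ/(289M²)` (`sepPotential₀_four_mul_ge`). This replaces the source's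
"it suffices to prove the lemma with `α = 0`", valid for this strip but not for the printed one
(`not_lemma_6_4_2_alpha_printed`). [cite: DafermosRodnianskiShlapentokhrothman2014, Lemma 6.4.2 (repaired α-clause)] -/
theorem exists_sepPotential₀_rmax_sub_sq_ge' {M a : ℝ} (hM : 0 < M) (ha0 : 0 ≤ a) (haM : a < M) :
    ∃ α₀ > 0, ∃ b > 0, ∀ α : ℝ, 0 ≤ α → α ≤ α₀ → ∀ (ω : ℝ) (m : ℤ) (Λ : ℝ),
      IsAdmissibleTriple a ω m Λ → 0 < (m : ℝ) * ω →
      (m : ℝ) * ω ≤ a * (m : ℝ) ^ 2 / (2 * M * rPlus M a) + α * (|(m : ℝ)| * √Λ) →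
      ∃ rmax, rPlus M a < rmax ∧ rmax < 7 * M ∧
        IsMaxOn (sepPotential₀ M a ω m Λ) (Ioi (rPlus M a)) rmax ∧
        deriv (sepPotential₀ M a ω m Λ) rmax = 0 ∧
        (∀ r ∈ Ioi (rPlus M a), r ≠ rmax → deriv (sepPotential₀ M a ω m Λ) r ≠ 0) ∧
        b * Λ ≤ sepPotential₀ M a ω m Λ rmax - ω ^ 2 := by
  have hMa : IsSubextremal M a := show |a| < M by rwa [abs_of_nonneg ha0]
  have hr0 : 0 < rPlus M a := hM.trans_le (M_le_rPlus' M a)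
  have hrM : M < rPlus M a := by
    have : 0 < √(M ^ 2 - a ^ 2) := Real.sqrt_pos.2 (by nlinarith)
    unfold rPlus; linarith
  have hr2 : rPlus M a ≤ 2 * M := rPlus_le_two_mul'' hM.le a
  have h2Mr : 0 < 2 * M * rPlus M a := mul_pos (mul_pos two_pos hM) hr0
  obtain ⟨b₀, hb₀, H₀⟩ := exists_sepPotential₀_sub_sq_ge hM ha0 haM
  -- the constants
  obtain ⟨p, hp_def⟩ : ∃ p : ℝ, p = a / (2 * M * rPlus M a) := ⟨_, rfl⟩
  have hp : 0 ≤ p := by rw [hp_def]; exact div_nonneg ha0 h2Mr.le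
  obtain ⟨B₀, hB₀_def⟩ : ∃ B₀ : ℝ, B₀ = 4 * (rPlus M a - M) * (M * rPlus M a - a ^ 2) := ⟨_, rfl⟩
  have hB₀ : 0 < B₀ := by
    rw [hB₀_def]
    refine mul_pos (mul_pos (by norm_num) (by linarith)) ?_
    linarith [mul_pos hM (sub_pos.2 hrM), mul_pos (sub_pos.2 haM) (add_pos_of_pos_of_nonneg hM ha0)]
  obtain ⟨D, hD_def⟩ : ∃ D : ℝ, D = 4 * a * M * (3 * rPlus M a ^ 2 - a ^ 2) := ⟨_, rfl⟩
  have hD : 0 ≤ D := by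
    rw [hD_def]
    have h' : a ^ 2 < rPlus M a ^ 2 := pow_lt_pow_left₀ (haM.trans hrM) ha0 two_ne_zero
    have : 0 ≤ 3 * rPlus M a ^ 2 - a ^ 2 := by linarith [sq_nonneg (rPlus M a)]
    positivity
  obtain ⟨α₀, hα₀_def⟩ : ∃ α₀ : ℝ,
      α₀ = min (min 1 (b₀ / (2 * (2 * p + 1)))) (min (B₀ / (2 * (D + 1))) (2 / (17 * M))) :=
    ⟨_, rfl⟩
  have hα₀ : 0 < α₀ := by
    rw [hα₀_def]
    exact lt_min (lt_min one_pos (by positivity)) (lt_min (by positivity) (by positivity))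
  obtain ⟨b, hb_def⟩ : ∃ b : ℝ, b = min (b₀ / 2) (4 / (289 * M ^ 2)) := ⟨_, rfl⟩
  have hb : 0 < b := by rw [hb_def]; exact lt_min (by positivity) (by positivity)
  refine ⟨α₀, hα₀, b, hb, fun α hα hαα₀ ω m Λ hadm hpos hle ↦ ?_⟩
  -- unpacking the smallness of `α` and of `b`
  rw [hα₀_def] at hαα₀
  have hα1 : α ≤ 1 := hαα₀.trans ((min_le_left _ _).trans (min_le_left _ _))
  have hαb : α ≤ b₀ / (2 * (2 * p + 1)) := hαα₀.trans ((min_le_left _ _).trans (min_le_right _ _))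
  have hαB : α ≤ B₀ / (2 * (D + 1)) := hαα₀.trans ((min_le_right _ _).trans (min_le_left _ _))
  have hαM : α ≤ 2 / (17 * M) := hαα₀.trans ((min_le_right _ _).trans (min_le_right _ _))
  have hb1 : b ≤ b₀ / 2 := by rw [hb_def]; exact min_le_left _ _
  have hb2 : b ≤ 4 / (289 * M ^ 2) := by rw [hb_def]; exact min_le_right _ _
  -- consequences of admissibility and `mω > 0`
  have hq1 : 1 ≤ |(m : ℝ)| := one_le_abs_of_mul_pos hpos
  have hΛ2 : 2 ≤ Λ := hadm.two_le hpos
  have hΛ : 0 < Λ := by linarith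
  have hms : |(m : ℝ)| * √Λ ≤ Λ := hadm.abs_mul_sqrt_le
  have hs : √Λ ^ 2 = Λ := Real.sq_sqrt hΛ.le
  have hs0 : 0 ≤ √Λ := Real.sqrt_nonneg Λ
  have hx : (m : ℝ) * ω = |(m : ℝ)| * |ω| := mul_eq_abs_mul_abs_of_pos hpos
  have hm2 : (m : ℝ) ^ 2 = |(m : ℝ)| ^ 2 := (sq_abs _).symm
  -- the printed-strip bound and case (b) of Lemma 6.3.1 (Lemma 6.4.1)
  have hsr : (m : ℝ) * ω ≤ a * (m : ℝ) ^ 2 / (2 * M * rPlus M a) + α * Λ :=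
    hle.trans (add_le_add le_rfl (mul_le_mul_of_nonneg_left hms hα))
  have hαs : 4 * a * M * α * (3 * rPlus M a ^ 2 - a ^ 2) <
      4 * (rPlus M a - M) * (M * rPlus M a - a ^ 2) := by
    have h1 : α * (2 * (D + 1)) ≤ B₀ := (le_div_iff₀ (by positivity)).1 hαB
    have h2 : 4 * a * M * α * (3 * rPlus M a ^ 2 - a ^ 2) = α * D := by rw [hD_def]; ring
    rw [h2, ← hB₀_def]
    linarith [mul_nonneg hα hD]
  obtain ⟨rmax, h1, h7, hposd, h0, hnegd⟩ :=
    sepPotential₀_caseB_of_superradiant hM ha0 haM hadm hΛ hα hαs hsr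
  obtain ⟨-, -, hmax⟩ :=
    sepPotential₀_isMaxOn_of_deriv_sign (ω := ω) (Λ := Λ) hMa h1 hposd hnegd
  have huniq : ∀ r ∈ Ioi (rPlus M a), r ≠ rmax → deriv (sepPotential₀ M a ω m Λ) r ≠ 0 := by
    intro s hs' hne
    rcases lt_or_gt_of_ne hne with h | h
    · exact (hposd s ⟨hs', h⟩).ne'
    · exact (hnegd s h).ne
  refine ⟨rmax, h1, h7, hmax, h0, huniq, ?_⟩
  -- the lower bound `bΛ ≤ V₀(rmax) − ω²`
  rcases le_or_gt ((m : ℝ) * ω) (a * (m : ℝ) ^ 2 / (2 * M * rPlus M a)) with hA | hB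
  · -- superradiant proper: the `α = 0` lemma
    obtain ⟨r₁, hr₁, hbr⟩ := H₀ ω m Λ hadm hpos hA
    have hle₁ : sepPotential₀ M a ω m Λ r₁ ≤ sepPotential₀ M a ω m Λ rmax :=
      isMaxOn_iff.1 hmax r₁ hr₁
    have e1 : b * Λ ≤ b₀ / 2 * Λ := mul_le_mul_of_nonneg_right hb1 hΛ.le
    have e2 : b₀ / 2 * Λ ≤ b₀ * Λ := mul_le_mul_of_nonneg_right (by linarith) hΛ.le
    linarith
  · rcases ha0.eq_or_lt with h0a | hapos
    · -- `a = 0`: `|ω| ≤ α√Λ`, and `V₀(4M) ≥ 8Λ/(289M²)`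
      have hωs : |ω| ≤ α * √Λ := by
        have h2 : |(m : ℝ)| * |ω| ≤ |(m : ℝ)| * (α * √Λ) := by
          rw [← hx]
          have : a * (m : ℝ) ^ 2 / (2 * M * rPlus M a) = 0 := by rw [← h0a]; simp
          rw [this, zero_add] at hle
          linarith
        exact le_of_mul_le_mul_left h2 (by linarith)
      have hω2 : ω ^ 2 ≤ α ^ 2 * Λ := by
        calc ω ^ 2 = |ω| ^ 2 := (sq_abs ω).symm
          _ ≤ (α * √Λ) ^ 2 := pow_le_pow_left₀ (abs_nonneg ω) hωs 2
          _ = α ^ 2 * Λ := by rw [mul_pow, hs]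
      have hα2 : α ^ 2 ≤ 4 / (289 * M ^ 2) := by
        have h3 : α ^ 2 ≤ (2 / (17 * M)) ^ 2 := pow_le_pow_left₀ hα hαM 2
        have h4 : (2 / (17 * M)) ^ 2 = 4 / (289 * M ^ 2) := by
          have hMne : M ≠ 0 := hM.ne'
          field_simp; ring
        linarith
      have h4M : rPlus M a < 4 * M := by linarith
      have hV4 : 8 * Λ / (289 * M ^ 2) ≤ sepPotential₀ M a ω m Λ (4 * M) :=
        sepPotential₀_four_mul_ge hM ha0 haM.le hadm.sq_le hpos.le
      have hle₄ : sepPotential₀ M a ω m Λ (4 * M) ≤ sepPotential₀ M a ω m Λ rmax :=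
        isMaxOn_iff.1 hmax (4 * M) h4M
      have e1 : b * Λ ≤ 4 / (289 * M ^ 2) * Λ := mul_le_mul_of_nonneg_right hb2 hΛ.le
      have e2 : α ^ 2 * Λ ≤ 4 / (289 * M ^ 2) * Λ := mul_le_mul_of_nonneg_right hα2 hΛ.le
      have e3 : 4 / (289 * M ^ 2) * Λ + 4 / (289 * M ^ 2) * Λ = 8 * Λ / (289 * M ^ 2) := by ring
      linarith
    · -- `a > 0`: compare with the threshold triple `(ω₊ m, m, Λ)`
      obtain ⟨ω₀, hω₀_def⟩ : ∃ ω₀ : ℝ, ω₀ = a * (m : ℝ) / (2 * M * rPlus M a) := ⟨_, rfl⟩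
      have hmω₀ : (m : ℝ) * ω₀ = a * (m : ℝ) ^ 2 / (2 * M * rPlus M a) := by rw [hω₀_def]; ring
      have hm1 : 1 ≤ (m : ℝ) ^ 2 := by
        rw [hm2, ← one_pow 2]; exact pow_le_pow_left₀ zero_le_one hq1 2
      have hpos₀ : 0 < (m : ℝ) * ω₀ := by
        rw [hmω₀]
        exact div_pos (mul_pos hapos (lt_of_lt_of_le one_pos hm1)) h2Mr
      have hle₀ : (m : ℝ) * ω₀ ≤ (m : ℝ) * ω := by rw [hmω₀]; exact hB.le
      have hadm₀ : IsAdmissibleTriple a ω₀ m Λ := by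
        refine ⟨hadm.1, le_trans ?_ hadm.2⟩
        have e1 : a * (m : ℝ) * ω₀ = a * ((m : ℝ) * ω₀) := by ring
        have e2 : a * (m : ℝ) * ω = a * ((m : ℝ) * ω) := by ring
        rw [e1, e2, abs_of_nonneg (mul_nonneg ha0 hpos₀.le), abs_of_nonneg (mul_nonneg ha0 hpos.le)]
        have := mul_le_mul_of_nonneg_left hle₀ ha0
        linarith
      obtain ⟨r₁, hr₁, hbr⟩ := H₀ ω₀ m Λ hadm₀ hpos₀ hmω₀.le
      have hmono : sepPotential₀ M a ω₀ m Λ r₁ ≤ sepPotential₀ M a ω m Λ r₁ :=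
        sepPotential₀_mono_omega hM.le ha0 (hr0.trans hr₁).le hle₀
      have hle₁ : sepPotential₀ M a ω m Λ r₁ ≤ sepPotential₀ M a ω m Λ rmax :=
        isMaxOn_iff.1 hmax r₁ hr₁
      -- `ω² − ω₀² ≤ (2pα + α²) Λ`
      have hq0 : 0 < |(m : ℝ)| := by linarith
      have hpq : a * (m : ℝ) ^ 2 / (2 * M * rPlus M a) = p * |(m : ℝ)| ^ 2 := by
        rw [hm2, hp_def]; ring
      have hy : |ω₀| = p * |(m : ℝ)| := by
        rw [hω₀_def, hp_def, abs_div, abs_mul, abs_of_nonneg ha0, abs_of_pos h2Mr]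
        ring
      have h5 : |ω| - p * |(m : ℝ)| ≤ α * √Λ := by
        have h' : |(m : ℝ)| * |ω| ≤ p * |(m : ℝ)| ^ 2 + α * (|(m : ℝ)| * √Λ) := by
          rw [← hx, ← hpq]; exact hle
        have h'' : |(m : ℝ)| * (|ω| - p * |(m : ℝ)|) ≤ |(m : ℝ)| * (α * √Λ) := by linarith
        exact le_of_mul_le_mul_left h'' hq0
      have h6 : p * |(m : ℝ)| < |ω| := by
        have h' : p * |(m : ℝ)| ^ 2 < |(m : ℝ)| * |ω| := by rw [← hx, ← hpq]; exact hB
        have h'' : |(m : ℝ)| * (p * |(m : ℝ)|) < |(m : ℝ)| * |ω| := by linarith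
        exact lt_of_mul_lt_mul_left h'' hq0.le
      have hω2 : ω ^ 2 - ω₀ ^ 2 ≤ (2 * p * α + α ^ 2) * Λ := by
        have e1 : ω ^ 2 = |ω| ^ 2 := (sq_abs ω).symm
        have e2 : ω₀ ^ 2 = (p * |(m : ℝ)|) ^ 2 := by rw [← hy, sq_abs]
        rw [e1, e2]
        have h8 : |ω| ^ 2 - (p * |(m : ℝ)|) ^ 2 = (|ω| - p * |(m : ℝ)|) * (|ω| + p * |(m : ℝ)|) := by
          ring
        have h9 : (|ω| - p * |(m : ℝ)|) * (|ω| + p * |(m : ℝ)|) ≤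
            (α * √Λ) * (2 * (p * |(m : ℝ)|) + α * √Λ) :=
          mul_le_mul h5 (by linarith) (by positivity) (by positivity)
        have h10 : (α * √Λ) * (2 * (p * |(m : ℝ)|) + α * √Λ) =
            2 * p * α * (|(m : ℝ)| * √Λ) + α ^ 2 * √Λ ^ 2 := by ring
        have h11 : 2 * p * α * (|(m : ℝ)| * √Λ) ≤ 2 * p * α * Λ :=
          mul_le_mul_of_nonneg_left hms (by positivity)
        have h12 : α ^ 2 * √Λ ^ 2 = α ^ 2 * Λ := by rw [hs]
        rw [h8]
        linarith
      -- `2pα + α² ≤ b₀/2`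
      have hsmall : (2 * p * α + α ^ 2) * Λ ≤ b₀ / 2 * Λ := by
        apply mul_le_mul_of_nonneg_right _ hΛ.le
        have h' : α * (2 * (2 * p + 1)) ≤ b₀ := (le_div_iff₀ (by positivity)).1 hαb
        linarith [mul_le_mul_of_nonneg_left hα1 hα]
      have e1 : b * Λ ≤ b₀ / 2 * Λ := mul_le_mul_of_nonneg_right hb1 hΛ.le
      linarith

/-- The same, packaged with the predicate `IsNearSuperradiant'` (`ω₊m² = am²/(2Mr₊)`).
[cite: DafermosRodnianskiShlapentokhrothman2014, Lemma 6.4.2 (repaired α-clause)] -/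
theorem exists_sepPotential₀_rmax_sub_sq_ge_of_isNearSuperradiant' {M a : ℝ} (hM : 0 < M)
    (ha0 : 0 ≤ a) (haM : a < M) :
    ∃ α₀ > 0, ∃ b > 0, ∀ α : ℝ, 0 ≤ α → α ≤ α₀ → ∀ (ω : ℝ) (m : ℤ) (Λ : ℝ),
      IsAdmissibleTriple a ω m Λ → IsNearSuperradiant' M a α ω m Λ →
      ∃ rmax, rPlus M a < rmax ∧ rmax < 7 * M ∧
        IsMaxOn (sepPotential₀ M a ω m Λ) (Ioi (rPlus M a)) rmax ∧
        b * Λ ≤ sepPotential₀ M a ω m Λ rmax - ω ^ 2 := by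
  obtain ⟨α₀, hα₀, b, hb, H⟩ := exists_sepPotential₀_rmax_sub_sq_ge' hM ha0 haM
  refine ⟨α₀, hα₀, b, hb, fun α hα hαα₀ ω m Λ hadm hS ↦ ?_⟩
  have hle := hS.2
  rw [horizonAngularVelocity_mul_sq] at hle
  obtain ⟨rmax, h1, h7, hmax, -, -, hbΛ⟩ := H α hα hαα₀ ω m Λ hadm hS.1 hle
  exact ⟨rmax, h1, h7, hmax, hbΛ⟩

/-! ### The uses of the strip's complement in §8.5 and §8.6 survive the repair -/

/-- **§8.5 for the repaired strip**: in `𝓖_𝄬` (off the repaired strip, `ω² < ε_width Λ`), if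
`ε_width ≤ α²` then `mω ≤ 0` — for `mω > 0` off the strip gives `|ω| > α√Λ`, i.e. `ω² > α²Λ ≥ ε_width Λ`.
As printed (for the printed strip): "we begin by arguing that `ε_width` sufficiently small implies
`mω ≤ 0` … This is a contradiction if we take `ε_width < α²`" (proof of Prop. 8.5.1).
[cite: DafermosRodnianskiShlapentokhrothman2014, Prop. 8.5.1 (proof)] -/
theorem mul_nonpos_of_isFreqLessflat' {M a α ωh ε ω Λ : ℝ} {m : ℤ} (hM : 0 ≤ M) (ha0 : 0 ≤ a)
    (hα : 0 ≤ α) (hεα : ε ≤ α ^ 2)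
    (h : IsFreqLessflat (IsNearSuperradiant' M a α) a ωh ε ω m Λ) : (m : ℝ) * ω ≤ 0 := by
  obtain ⟨hadm, -, hω2, hS⟩ := h
  by_contra hpos
  push Not at hpos
  have hΛ := hadm.nonneg
  have hp : 0 ≤ horizonAngularVelocity M a := horizonAngularVelocity_nonneg hM ha0
  have hq1 : 1 ≤ |(m : ℝ)| := one_le_abs_of_mul_pos hpos
  have hx : (m : ℝ) * ω = |(m : ℝ)| * |ω| := mul_eq_abs_mul_abs_of_pos hpos
  have hs : √Λ ^ 2 = Λ := Real.sq_sqrt hΛ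
  have hlt : horizonAngularVelocity M a * (m : ℝ) ^ 2 + α * (|(m : ℝ)| * √Λ) < (m : ℝ) * ω := by
    by_contra hle; exact hS ⟨hpos, not_lt.1 hle⟩
  -- `|m| |ω| > α |m| √Λ`, so `|ω| > α √Λ`
  have h1 : α * √Λ < |ω| := by
    have h' : |(m : ℝ)| * (α * √Λ) < |(m : ℝ)| * |ω| := by
      rw [← hx]; linarith [mul_nonneg hp (sq_nonneg (m : ℝ))]
    exact lt_of_mul_lt_mul_left h' (by linarith)
  have h2 : α ^ 2 * Λ < ω ^ 2 := by
    calc α ^ 2 * Λ = (α * √Λ) ^ 2 := by rw [mul_pow, hs]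
      _ < |ω| ^ 2 := pow_lt_pow_left₀ h1 (by positivity) two_ne_zero
      _ = ω ^ 2 := sq_abs ω
  have h3 : ε * Λ ≤ α ^ 2 * Λ := mul_le_mul_of_nonneg_right hεα hΛ
  linarith

/-- **§8.5 as printed** (printed strip): in `𝓖_𝄬` with `0 < ε_width ≤ α²` and `α ≥ 0`,
`mω ≤ 0`. The printed argument: `mω > 0` off the strip gives `mω ≥ αΛ ≥ αε_width⁻¹ω²`, so
`|m| ≥ αε_width⁻¹|ω|`, and `|ω| ≥ αΛ|m|⁻¹ ≥ α|m|`, whence `|ω| ≥ α²ε_width⁻¹|ω|`, "a contradiction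
if we take `ε_width < α²`" (for `ε_width = α²` the strict inequalities still clash).
[cite: DafermosRodnianskiShlapentokhrothman2014, Prop. 8.5.1 (proof)] -/
theorem mul_nonpos_of_isFreqLessflat {M a α ωh ε ω Λ : ℝ} {m : ℤ} (hM : 0 ≤ M) (ha0 : 0 ≤ a)
    (hα : 0 ≤ α) (hε : 0 < ε) (hεα : ε ≤ α ^ 2)
    (h : IsFreqLessflat (IsNearSuperradiant M a α) a ωh ε ω m Λ) : (m : ℝ) * ω ≤ 0 := by
  obtain ⟨hadm, -, hω2, hS⟩ := h
  by_contra hpos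
  push Not at hpos
  have hΛ := hadm.nonneg
  have hp : 0 ≤ horizonAngularVelocity M a := horizonAngularVelocity_nonneg hM ha0
  have hq1 : 1 ≤ |(m : ℝ)| := one_le_abs_of_mul_pos hpos
  have hx : (m : ℝ) * ω = |(m : ℝ)| * |ω| := mul_eq_abs_mul_abs_of_pos hpos
  have hq2 : |(m : ℝ)| ^ 2 ≤ Λ := by rw [sq_abs]; exact hadm.sq_le
  have hx0 : 0 < |ω| := abs_pos.2 (by rintro rfl; simp at hpos)
  have hlt : horizonAngularVelocity M a * (m : ℝ) ^ 2 + α * Λ < (m : ℝ) * ω := by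
    by_contra hle; exact hS ⟨hpos, not_lt.1 hle⟩
  -- (1) `|m| |ω| > α Λ`; (2) `ε Λ > |ω|²`; (3) `Λ ≥ |m|²`
  have h1 : α * Λ < |(m : ℝ)| * |ω| := by
    rw [← hx]; linarith [mul_nonneg hp (sq_nonneg (m : ℝ))]
  have h2 : |ω| ^ 2 < ε * Λ := by rw [sq_abs]; exact hω2
  -- `|ω| > α |m|` from (1),(3); `α |ω|² < ε |m| |ω|` from (1),(2); so `α|ω| < ε|m| ≤ α²|m| ≤ α|ω|`
  have h3 : α * |(m : ℝ)| < |ω| := by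
    have h' : α * |(m : ℝ)| ^ 2 ≤ α * Λ := mul_le_mul_of_nonneg_left hq2 hα
    have h'' : |(m : ℝ)| * (α * |(m : ℝ)|) < |(m : ℝ)| * |ω| := by linarith
    exact lt_of_mul_lt_mul_left h'' (by linarith)
  have h4 : α * |ω| * |ω| < ε * |(m : ℝ)| * |ω| := by
    have e1 := mul_le_mul_of_nonneg_left h2.le hα
    have e2 := mul_lt_mul_of_pos_left h1 hε
    linarith
  have h5 : α * |ω| < ε * |(m : ℝ)| := lt_of_mul_lt_mul_right h4 hx0.le
  have h6 : α * (α * |(m : ℝ)|) ≤ α * |ω| := mul_le_mul_of_nonneg_left h3.le hα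
  have h7 : ε * |(m : ℝ)| ≤ α ^ 2 * |(m : ℝ)| := mul_le_mul_of_nonneg_right hεα (by linarith)
  linarith

/-- **§8.6 for the repaired strip**: for `M ≥ 0`, `a ≥ 0`, `α ≥ 0`, an admissible triple off the
repaired strip with `ε Λ ≤ ω²`, `(ω − ω₊m)² ≥ min(ε, α²) Λ` — if `mω ≤ 0` then `(ω − ω₊m)² ≥ ω² ≥ εΛ`
(`ω₊ ≥ 0`), and if `mω > 0` then off the strip `|ω| − ω₊|m| > α√Λ`, so
`(ω − ω₊m)² = (|ω| − ω₊|m|)² > α²Λ`. This is the first display of the proof of Lemma 8.6.1: "Since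
`mω ∉ (0, am²/(2Mr₊) + αΛ]` and `ε_width Λ ≤ ω² ≤ ε_width⁻¹Λ`, we find
`ω² − V(r₊) = ω² − V₀(r₊) ≥ cΛ`" (and `ω² − V₀(r₊) = (ω − ω₊m)²`, Lemma 6.3.2).
[cite: DafermosRodnianskiShlapentokhrothman2014, Lemma 8.6.1 (proof, first display)] -/
theorem min_mul_le_sq_sub_of_not_isNearSuperradiant' {M a α ε ω Λ : ℝ} {m : ℤ} (hM : 0 ≤ M)
    (ha0 : 0 ≤ a) (hα : 0 ≤ α) (hadm : IsAdmissibleTriple a ω m Λ)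
    (hS : ¬ IsNearSuperradiant' M a α ω m Λ) (hω : ε * Λ ≤ ω ^ 2) :
    min ε (α ^ 2) * Λ ≤ (ω - horizonAngularVelocity M a * m) ^ 2 := by
  have hΛ := hadm.nonneg
  set p := horizonAngularVelocity M a with hp_def
  have hp : 0 ≤ p := horizonAngularVelocity_nonneg hM ha0
  rcases le_or_gt ((m : ℝ) * ω) 0 with hnp | hpos
  · -- `mω ≤ 0`: `(ω − pm)² ≥ ω² ≥ εΛ`
    have h1 : ω ^ 2 ≤ (ω - p * m) ^ 2 := by
      linarith [mul_nonneg hp (neg_nonneg.2 hnp), sq_nonneg (p * m)]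
    have h2 : min ε (α ^ 2) * Λ ≤ ε * Λ := mul_le_mul_of_nonneg_right (min_le_left _ _) hΛ
    linarith
  · have hq1 : 1 ≤ |(m : ℝ)| := one_le_abs_of_mul_pos hpos
    have hx : (m : ℝ) * ω = |(m : ℝ)| * |ω| := mul_eq_abs_mul_abs_of_pos hpos
    have hm2 : (m : ℝ) ^ 2 = |(m : ℝ)| ^ 2 := (sq_abs _).symm
    have hs : √Λ ^ 2 = Λ := Real.sq_sqrt hΛ
    have hs0 : 0 ≤ √Λ := Real.sqrt_nonneg Λ
    have hlt : p * (m : ℝ) ^ 2 + α * (|(m : ℝ)| * √Λ) < (m : ℝ) * ω := by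
      by_contra hle; exact hS ⟨hpos, not_lt.1 hle⟩
    have hq0 : 0 < |(m : ℝ)| := by linarith
    -- `|ω| − p |m| > α √Λ`
    have h1 : α * √Λ < |ω| - p * |(m : ℝ)| := by
      have h' : |(m : ℝ)| * (p * |(m : ℝ)| + α * √Λ) < |(m : ℝ)| * |ω| := by
        rw [← hx]; rw [hm2] at hlt; linarith
      have := lt_of_mul_lt_mul_left h' hq0.le
      linarith
    have h2 : α ^ 2 * Λ < (|ω| - p * |(m : ℝ)|) ^ 2 := by
      calc α ^ 2 * Λ = (α * √Λ) ^ 2 := by rw [mul_pow, hs]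
        _ < (|ω| - p * |(m : ℝ)|) ^ 2 := pow_lt_pow_left₀ h1 (by positivity) two_ne_zero
    -- `(ω − p m)² = (|ω| − p |m|)²` since `mω > 0`
    have e5 : |(m : ℝ)| * |ω| = (m : ℝ) * ω := hx.symm
    have hω2 : |ω| ^ 2 = ω ^ 2 := sq_abs ω
    have hq2 : |(m : ℝ)| ^ 2 = (m : ℝ) ^ 2 := sq_abs _
    have h3 : (ω - p * m) ^ 2 = (|ω| - p * |(m : ℝ)|) ^ 2 := by
      linear_combination (-1 : ℝ) * hω2 + (-p ^ 2) * hq2 + (2 * p) * e5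
    have h4 : min ε (α ^ 2) * Λ ≤ α ^ 2 * Λ := mul_le_mul_of_nonneg_right (min_le_right _ _) hΛ
    rw [h3]
    linarith

/-- The same for the **printed** strip (whose complement is smaller: for admissible triples the
repaired strip lies inside the printed one). [cite: DafermosRodnianskiShlapentokhrothman2014, Lemma 8.6.1 (proof, first display)] -/
theorem min_mul_le_sq_sub_of_not_isNearSuperradiant {M a α ε ω Λ : ℝ} {m : ℤ} (hM : 0 ≤ M)
    (ha0 : 0 ≤ a) (hα : 0 ≤ α) (hadm : IsAdmissibleTriple a ω m Λ)
    (hS : ¬ IsNearSuperradiant M a α ω m Λ) (hω : ε * Λ ≤ ω ^ 2) :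
    min ε (α ^ 2) * Λ ≤ (ω - horizonAngularVelocity M a * m) ^ 2 :=
  min_mul_le_sq_sub_of_not_isNearSuperradiant' hM ha0 hα hadm
    (fun h ↦ hS (h.isNearSuperradiant hadm hα)) hω

/-- **The first display of the proof of Lemma 8.6.1, in the printed form**: for `0 < M`,
`0 ≤ a ≤ M`, `α ≥ 0`, an admissible triple off the repaired (a fortiori off the printed) strip with
`ε_width Λ ≤ ω²`, `ω² − V₀(r₊) ≥ min(ε_width, α²) Λ` (`ω² − V₀(r₊) = (2Mr₊ω − am)²/(4M²r₊²) =
(ω − ω₊m)²`, `sepPotential₀_rPlus_eq`). [cite: DafermosRodnianskiShlapentokhrothman2014, Lemma 8.6.1 (proof, first display)] -/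
theorem min_mul_le_sq_sub_sepPotential₀_rPlus {M a α ε ω Λ : ℝ} {m : ℤ} (hM : 0 < M)
    (ha0 : 0 ≤ a) (haM : a ≤ M) (hα : 0 ≤ α) (hadm : IsAdmissibleTriple a ω m Λ)
    (hS : ¬ IsNearSuperradiant' M a α ω m Λ) (hω : ε * Λ ≤ ω ^ 2) :
    min ε (α ^ 2) * Λ ≤ ω ^ 2 - sepPotential₀ M a ω m Λ (rPlus M a) := by
  have h : |a| ≤ M := by rwa [abs_of_nonneg ha0]
  have hr0 : 0 < rPlus M a := hM.trans_le (M_le_rPlus' M a)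
  have hrne : rPlus M a ≠ 0 := hr0.ne'
  have hMne : M ≠ 0 := hM.ne'
  have h1 := min_mul_le_sq_sub_of_not_isNearSuperradiant' hM.le ha0 hα hadm hS hω
  have h2 : ω ^ 2 - sepPotential₀ M a ω m Λ (rPlus M a) =
      (ω - horizonAngularVelocity M a * m) ^ 2 := by
    rw [sepPotential₀_rPlus_eq h hM ω m Λ]
    unfold horizonAngularVelocity
    field_simp
    ring
  rw [h2]
  exact h1

end Kerr

end Literature.Geometry.Lorentzian

end
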